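import Mathlib.Analysis.InnerProductSpace.Adjoint
import Mathlib.Analysis.InnerProductSpace.Positive
import Mathlib.Analysis.CStarAlgebra.Classes
import Literature.NumberTheory.ConnesConsani2021.ProlateProjections
import Literature.NumberTheory.ConnesConsani2021.QuasiInnerSoninSpace
import Literature.NumberTheory.ConnesConsani2021.CutoffProjHatSincKernel
import Literature.Analysis.OperatorTheory.CompactPositiveTopLevel
import Literature.Analysis.OperatorTheory.TightSupNormCompactOperator
import Literature.Analysis.Fourier.FourierCompactSupportAnalytic
import Literature.Analysis.Fourier.L2FourierReflection
import Literature.Analysis.Fourier.SmoothWindowKernel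
import Literature.Analysis.FunctionSpaces.FourierSobolevNormEmbeddingProofs
import HarnessLib

/-!
# Sonin's space `S(α, β)` is infinite dimensional; Connes–Consani JNT 2021 Thm 5.3 (i) — PROVED

RH-FREE classical harmonic analysis (the Sonin space of the cosine transform); cell `rh-crit`, C1
Connes–Consani corpus, sequel P5 (no leaf role).  Theorems only: no definition, no named fact, no
instance.  Nothing in this file bears on the truth of RH.

Sonin's space `S(α, β) ⊆ L²(ℝ)_ev` (Connes–Consani, Selecta 2021, Def. 4.4; the tree's
`soninSpace α β`, `ArchimedeanSoninTrace.lean`) consists of the even `ξ ∈ L²(ℝ)` vanishing a.e. on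
`[−α, α]` whose Fourier transform vanishes a.e. on `[−β, β]`; equivalently (`mem_soninSpace_iff_cutoffProj`)
the even part of the joint kernel of the two cutoff projections `𝒫_α` (multiplication by `1_{[−α,α]}`)
and `𝒫̂_β = 𝓕⁻¹𝒫_β𝓕` of `ProlateProjections.lean`.  That `S(1,1)` — the space of N. Sonin (1880) —
is INFINITE DIMENSIONAL is quoted without proof in Connes–Consani, *Quasi-inner functions and local
factors*, J. Number Theory 2021, proof of Thm. 5.3 (i) (§5.4, "the well-known infinite dimensional
Sonin's space"); seat t18 typed Thm. 5.3 (i) as the named fact `QuasiInner.thm_5_3_i` and PROVED the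
reduction `QuasiInner.thm_5_3_i_of_not_finiteDimensional_soninSpace`.  This file proves the missing
classical input and discharges the fact.

## The printed argument followed (Burnol)

J.-F. Burnol, *On Fourier and Zeta(s)*, Forum Math. 16 (2004) [`Burnol2004`], §6, the paragraph after
Def. 6.1 (arXiv:math/0112254, p. 22 of the text): "An existence proof of Sonine square-integrable
functions is straightforward: it suffices to say that `L²(0,λ) + 𝓕₊(L²(0,λ))` is a closed (obviously
proper) subspace of `L²(0,∞)`.  The (thus non trivial) perpendicular complement is the space `K_λ`.
That the space sum is closed follows readily from the fact that the compact operator `P_λ𝓕₊P_λ` has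
operator bound strictly less than one (as no function can be compactly supported and with its Fourier
compactly supported)"; and J.-F. Burnol, *Two complete and minimal systems …*, JTNB 16 (2004)
[`Burnol2004b`], §2 (arXiv:math/0203120, p. 5): "Elementary arguments … prove that the [Sonine spaces]
for `0 < a < ∞` compose a strictly decreasing chain of non-trivial infinite dimensional subspaces".
(`K_λ` = the tree's `soninSpace λ λ` read on even functions; the original statements are N. Sonin,
Math. Ann. 16 (1880) and L. de Branges, J. Math. Anal. Appl. 9 (1964), Thm., cited there.)

Lean route, mirroring that paragraph for general windows `[−a, a]`, `[−b, b]`: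
* §A (abstract Hilbert space): `isClosed_range_sup_range` — for star projections `P, Q` with
  `‖P ∘ Q‖ < 1` the sum `ran P + ran Q` is closed (`‖k + l‖² ≥ (1 − ‖P∘Q‖)(‖k‖² + ‖l‖²)`, so
  `(k, l) ↦ k + l` is bounded below); `norm_comp_lt_one_of_isCompactOperator` — if moreover `P ∘ Q` is
  compact and `ran P ⊓ ran Q = ⊥` then `‖P ∘ Q‖ < 1` (the compact positive operator `PQP` attains its
  norm at an eigenvector, the tree's `exists_eigenvector_norm_of_re_inner_nonneg`; an eigenvector for
  `1` would lie in `ran P ∩ ran Q`).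
* §B (the pair `𝒫_a`, `𝒫̂_b` on `L²(ℝ)`): `𝒫̂_b φ` is the inverse Fourier integral of the integrable
  function `1_{[−b,b]}𝓕φ` (`cutoffProjHat_coeFn_ae_eq_fourierInv`), hence continuous and bounded by
  `√(vol[−b,b])‖φ‖₂` (`eLpNorm_top_cutoffProjHat_le`); so `𝒫_a𝒫̂_b` is compact (the tree's
  `isCompactOperator_indicatorLp_comp`), `ran 𝒫_a ⊓ ran 𝒫̂_b = ⊥` (the Fourier transform of a compactly
  supported `L¹` function is entire — the tree's `ae_eq_zero_of_fourier_eqOn_Ioo`), hence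
  `‖𝒫_a𝒫̂_b‖ < 1` and `ran 𝒫_a + ran 𝒫̂_b` is closed.
* §C ("obviously proper"): the even step function `1_{a+1<|x|<a+2}` is not in `ran 𝒫_a + ran 𝒫̂_b`
  (on `|x| > a` it would agree a.e. with a continuous band-limited function, which cannot jump at
  `a + 1`); projecting it onto `(ran 𝒫_a + ran 𝒫̂_b)ᗮ` gives a non-zero EVEN vector of the joint kernel
  (both projections commute with the reflection `x ↦ −x`): `exists_mem_soninSpace_ne_zero` (`a ≥ 0`),
  `soninSpace_ne_bot` (all `a, b`).
* §D: `not_finiteDimensional_soninSpace (a b : ℝ) : ¬ FiniteDimensional ℂ (soninSpace a b)` — the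
  chain `S(a+n, b+n)`, `n ∈ ℕ`, of NON-ZERO subspaces of `S(a, b)` (`a ≥ 0`) has zero intersection, so it
  cannot be eventually constant, as it would be if `S(a, b)` were finite dimensional; `a < 0` reduces to
  `a = 0` since `S(a, b) ⊇ S(0, b)`.
* §E: `QuasiInner.thm_5_3_i_holds : QuasiInner.thm_5_3_i` (net named-fact debt −1).

Deviations from print: Burnol works on `(0, ∞)` with one window `λ` for both sides; we work with even
functions on `ℝ` (the tree's `soninSpace`) and independent windows `a, b`, which changes nothing.  The
explicit (Kahane) Schwartz-class examples of [`Burnol2004`, §6 p. 22] and de Branges' structure theory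
are deliberately NOT here.

## Tree search

`soninSpace`, `mem_soninSpace_iff_cutoffProj`, `cutoffProj`, `cutoffProjHat`, `isStarProjection_cutoffProj(Hat)`,
`evenPart`, `compNeg_cutoffProj` (cell files); `Literature.Analysis.OperatorTheory.{exists_eigenvector_norm_of_re_inner_nonneg,
isCompactOperator_indicatorLp_comp, indicatorLp, integral_norm_coeFn_le_sqrt_mul_norm}`;
`Literature.Analysis.Fourier.{ae_eq_zero_of_fourier_eqOn_Ioo, fourier_compNeg, fourierInv_compNeg, coeFn_compNeg,
continuous_fourierInv_of_integrable, norm_fourierInv_le_integral_norm}`;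
`Literature.Analysis.FunctionSpaces.{fourier_toLp_ae_eq_fourierIntegral, continuous_fourierIntegral,
SobolevEmbeddingHalf.fourierInv_toLp_ae_eq_fourierIntegralInv}`.  No statement "Sonin space non-zero /
infinite dimensional" existed (`lean search 'soninSpace'`, `'FiniteDimensional.*sonin'`).

## References

* J.-F. Burnol, *On Fourier and Zeta(s)*, Forum Math. 16 (2004) 789–840, §6 (arXiv:math/0112254,
  Def. 6.1, Thm. 6.3, Prop. 6.6 and the existence paragraph, p. 22). [`Burnol2004`]
* J.-F. Burnol, *Two complete and minimal systems associated with the zeros of the Riemann zeta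
  function*, J. Théor. Nombres Bordeaux 16 (2004) 65–94, §2 (arXiv:math/0203120, p. 5, Thm. 2.1).
  [`Burnol2004b`]
* A. Connes, C. Consani, *Quasi-inner functions and local factors*, J. Number Theory 226 (2021), Thm. 5.3
  (i), proof §5.4 (arXiv:2008.10974, chunk p0015:L22, p0016:L29). [`ConnesConsani2021QuasiInner`]
* A. Connes, C. Consani, *Weil positivity and trace formula, the archimedean place*, Selecta Math. 27
  (2021), Def. 4.4 §4 p. 16. [`ConnesConsani2021`]
* W. O. Amrein, A. M. Berthier, *On support properties of Lᵖ-functions and their Fourier transforms*,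
  J. Funct. Anal. 24 (1977) 258–267, Prop. 2–3 p. 260 (`dim(E_A^⊥ ∩ F_B^⊥)ℋ = ∞` for `A, B` of finite
  measure; located by seat t18 g2). [`AmreinBerthier1977`]
-/

noncomputable section

open MeasureTheory Set Filter Function FourierTransform
open scoped InnerProductSpace ComplexConjugate ENNReal FourierTransform Topology InnerProduct

namespace Literature.NumberTheory.ConnesConsani2021

/-! ## A. Two abstract Hilbert-space lemmas on pairs of orthogonal projections -/

section Abstract

variable {E : Type*} [NormedAddCommGroup E] [InnerProductSpace ℂ E] [CompleteSpace E]

/-- For star projections `P`, `Q` and `k ∈ ran P`, `l ∈ ran Q`: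
`(1 - ‖P ∘ Q‖) (‖k‖² + ‖l‖²) ≤ ‖k + l‖²`. [folklore] -/
private theorem norm_add_sq_ge_of_isStarProjection {P Q : E →L[ℂ] E} (hP : IsStarProjection P)
    {k l : E} (hk : P k = k) (hl : Q l = l) :
    (1 - ‖P ∘L Q‖) * (‖k‖ ^ 2 + ‖l‖ ^ 2) ≤ ‖k + l‖ ^ 2 := by
  have hPs := hP.isSelfAdjoint.isSymmetric
  have h1 : ‖⟪k, l⟫_ℂ‖ ≤ ‖P ∘L Q‖ * (‖k‖ * ‖l‖) := by
    have heq : ⟪k, l⟫_ℂ = ⟪k, (P ∘L Q) l⟫_ℂ := by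
      rw [ContinuousLinearMap.comp_apply, hl]
      conv_lhs => rw [← hk]
      exact hPs k l
    rw [heq]
    calc ‖⟪k, (P ∘L Q) l⟫_ℂ‖ ≤ ‖k‖ * ‖(P ∘L Q) l‖ := norm_inner_le_norm _ _
      _ ≤ ‖k‖ * (‖P ∘L Q‖ * ‖l‖) := by
          gcongr; exact ContinuousLinearMap.le_opNorm _ _
      _ = ‖P ∘L Q‖ * (‖k‖ * ‖l‖) := by ring
  have h2 : ‖k + l‖ ^ 2 = ‖k‖ ^ 2 + 2 * RCLike.re ⟪k, l⟫_ℂ + ‖l‖ ^ 2 := norm_add_sq (𝕜 := ℂ) k l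
  have h3 : |RCLike.re ⟪k, l⟫_ℂ| ≤ ‖⟪k, l⟫_ℂ‖ := RCLike.abs_re_le_norm _
  have h4 : -‖⟪k, l⟫_ℂ‖ ≤ RCLike.re ⟪k, l⟫_ℂ := (abs_le.mp h3).1
  have h5 : 2 * (‖k‖ * ‖l‖) ≤ ‖k‖ ^ 2 + ‖l‖ ^ 2 := by nlinarith [sq_nonneg (‖k‖ - ‖l‖)]
  have h6 : 0 ≤ ‖P ∘L Q‖ := norm_nonneg _
  nlinarith [h1, h4, h5, h6, norm_nonneg k, norm_nonneg l, mul_nonneg h6 (sub_nonneg.2 h5)]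

/-- The range of a star projection on a Hilbert space is closed. [folklore] -/
private theorem isClosed_range_of_isStarProjection {P : E →L[ℂ] E} (hP : IsStarProjection P) :
    IsClosed ((P.range : Submodule ℂ E) : Set E) :=
  ContinuousLinearMap.IsIdempotentElem.isClosed_range hP.isIdempotentElem

omit [CompleteSpace E] in
/-- For an idempotent `P`, `x ∈ ran P ↔ P x = x`. [folklore] -/
private theorem mem_range_iff_of_isIdempotentElem {P : E →L[ℂ] E} (hP : IsIdempotentElem P) {x : E} :
    x ∈ P.range ↔ P x = x := by
  constructor
  · rintro ⟨y, rfl⟩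
    exact congrArg (fun R : E →L[ℂ] E => R y) hP.eq
  · intro h
    exact ⟨x, h⟩

/-- **Closed sum of two ranges.** If `P, Q` are star projections with `‖P ∘ Q‖ < 1`, then
`ran P + ran Q` is closed (the minimal angle between the ranges is positive; F. Deutsch, *The angle
between subspaces of a Hilbert space* (1995), Thm. 12; used in Burnol's existence proof).
[cite: Burnol2004, §6, existence paragraph after Def. 6.1 (arXiv p. 22)] -/
theorem isClosed_range_sup_range {P Q : E →L[ℂ] E} (hP : IsStarProjection P)
    (hQ : IsStarProjection Q) (h : ‖P ∘L Q‖ < 1) :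
    IsClosed ((P.range ⊔ Q.range : Submodule ℂ E) : Set E) := by
  set K : Submodule ℂ E := P.range with hKdef
  set L : Submodule ℂ E := Q.range with hLdef
  haveI : CompleteSpace K := (isClosed_range_of_isStarProjection hP).completeSpace_coe
  haveI : CompleteSpace L := (isClosed_range_of_isStarProjection hQ).completeSpace_coe
  set T : (K × L) →L[ℂ] E := K.subtypeL.coprod L.subtypeL with hTdef
  set c : ℝ := ‖P ∘L Q‖ with hc
  have hc1 : 0 < 1 - c := by linarith
  have hs : 0 < Real.sqrt (1 - c) := Real.sqrt_pos.mpr hc1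
  have hs2 : Real.sqrt (1 - c) ^ 2 = 1 - c := Real.sq_sqrt hc1.le
  have hT : ∀ (k : K) (l : L), T (k, l) = (k : E) + (l : E) := fun k l => by
    simp [hTdef, ContinuousLinearMap.coprod_apply]
  -- bound from below
  set C : NNReal := ⟨(Real.sqrt (1 - c))⁻¹, by positivity⟩ with hCdef
  have hbound : ∀ x : K × L, ‖x‖ ≤ (C : ℝ) * ‖T x‖ := by
    rintro ⟨⟨k, hk⟩, ⟨l, hl⟩⟩
    have hk' : P k = k := (mem_range_iff_of_isIdempotentElem hP.isIdempotentElem).1 hk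
    have hl' : Q l = l := (mem_range_iff_of_isIdempotentElem hQ.isIdempotentElem).1 hl
    have hkey := norm_add_sq_ge_of_isStarProjection (Q := Q) hP hk' hl'
    rw [hT, Prod.norm_def]
    change max ‖k‖ ‖l‖ ≤ (Real.sqrt (1 - c))⁻¹ * ‖k + l‖
    rw [le_inv_mul_iff₀ hs]
    have hm : ∀ t : ℝ, 0 ≤ t → t ^ 2 ≤ ‖k‖ ^ 2 + ‖l‖ ^ 2 →
        Real.sqrt (1 - c) * t ≤ ‖k + l‖ := by
      intro t ht ht2
      have hsq : (Real.sqrt (1 - c) * t) ^ 2 ≤ ‖k + l‖ ^ 2 := by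
        rw [mul_pow, hs2]
        exact (mul_le_mul_of_nonneg_left ht2 hc1.le).trans hkey
      exact (pow_le_pow_iff_left₀ (by positivity) (norm_nonneg _) two_ne_zero).1 hsq
    rw [mul_max_of_nonneg _ _ hs.le]
    exact max_le (hm ‖k‖ (norm_nonneg _) (by nlinarith [sq_nonneg ‖l‖]))
      (hm ‖l‖ (norm_nonneg _) (by nlinarith [sq_nonneg ‖k‖]))
  have hanti : AntilipschitzWith C T := ContinuousLinearMap.antilipschitz_of_bound T hbound
  have hclosed : IsClosed (Set.range T) := hanti.isClosed_range T.uniformContinuous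
  have hrange : Set.range T = ((K ⊔ L : Submodule ℂ E) : Set E) := by
    ext x
    simp only [Set.mem_range, SetLike.mem_coe, Submodule.mem_sup]
    constructor
    · rintro ⟨⟨k, l⟩, rfl⟩
      exact ⟨k, k.2, l, l.2, (hT k l).symm⟩
    · rintro ⟨k, hk, l, hl, rfl⟩
      exact ⟨(⟨k, hk⟩, ⟨l, hl⟩), hT _ _⟩
  rwa [hrange] at hclosed

/-- A star projection has norm `≤ 1`. [folklore] -/
private theorem norm_le_one_of_isStarProjection {P : E →L[ℂ] E} (hP : IsStarProjection P) : ‖P‖ ≤ 1 := by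
  obtain ⟨hK, hPe⟩ := isStarProjection_iff_eq_starProjection_range.mp hP
  rw [hPe]
  exact Submodule.starProjection_norm_le _

/-- For a star projection `Q`, `Re ⟪x, Q x⟫ = ‖Q x‖²`. [folklore] -/
private theorem re_inner_apply_of_isStarProjection {Q : E →L[ℂ] E} (hQ : IsStarProjection Q) (x : E) :
    RCLike.re ⟪x, Q x⟫_ℂ = ‖Q x‖ ^ 2 := by
  have hQs := hQ.isSelfAdjoint.isSymmetric
  have h1 : Q (Q x) = Q x := congrArg (fun R : E →L[ℂ] E => R x) hQ.isIdempotentElem.eq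
  have h2 : ⟪x, Q x⟫_ℂ = ⟪Q x, Q x⟫_ℂ := by
    calc ⟪x, Q x⟫_ℂ = ⟪x, Q (Q x)⟫_ℂ := by rw [h1]
      _ = ⟪Q x, Q x⟫_ℂ := (hQs x (Q x)).symm
  rw [h2]
  exact inner_self_eq_norm_sq (𝕜 := ℂ) (Q x)

/-- For a star projection `Q`, `‖Q x‖ = ‖x‖` forces `Q x = x`. [folklore] -/
private theorem apply_eq_self_of_norm_eq {Q : E →L[ℂ] E} (hQ : IsStarProjection Q) {x : E}
    (h : ‖Q x‖ = ‖x‖) : Q x = x := by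
  obtain ⟨hK, hQe⟩ := isStarProjection_iff_eq_starProjection_range.mp hQ
  have hx : x ∈ Q.range := by
    rw [hQe] at h
    exact (Submodule.mem_iff_norm_starProjection _ x).2 h
  exact (mem_range_iff_of_isIdempotentElem hQ.isIdempotentElem).1 hx

/-- **`‖P ∘ Q‖ < 1` for projections in "compact relative position" with `ran P ∩ ran Q = 0`.**
If `P, Q` are star projections on a Hilbert space, `P ∘ Q` is a compact operator and
`ran P ⊓ ran Q = ⊥`, then `‖P ∘ Q‖ < 1` (the compact positive operator `P Q P` attains its norm at
an eigenvector; an eigenvector for the eigenvalue `1` would lie in `ran P ∩ ran Q`) — the abstract form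
of "the compact operator `P_λ𝓕₊P_λ` has operator bound strictly less than one (as no function can be
compactly supported and with its Fourier compactly supported)".
[cite: Burnol2004, §6, existence paragraph after Def. 6.1 (arXiv p. 22)] -/
theorem norm_comp_lt_one_of_isCompactOperator {P Q : E →L[ℂ] E} (hP : IsStarProjection P)
    (hQ : IsStarProjection Q) (hc : IsCompactOperator (P ∘L Q))
    (hPQ : P.range ⊓ Q.range = ⊥) : ‖P ∘L Q‖ < 1 := by
  -- the trivial space
  rcases subsingleton_or_nontrivial E with hE | hE
  · have : ‖P ∘L Q‖ = 0 := by
      refine le_antisymm (ContinuousLinearMap.opNorm_le_bound _ le_rfl fun x => ?_) (norm_nonneg _)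
      rw [Subsingleton.elim x 0, map_zero, norm_zero, mul_zero]
    rw [this]; exact zero_lt_one
  -- `B = P Q P`
  set B : E →L[ℂ] E := P ∘L Q ∘L P with hBdef
  have hPadj : P† = P := hP.isSelfAdjoint.adjoint_eq
  have hQadj : Q† = Q := hQ.isSelfAdjoint.adjoint_eq
  have hBpos : B.IsPositive := by
    have := (ContinuousLinearMap.IsPositive.of_isStarProjection hQ).conj_adjoint P
    rwa [hPadj] at this
  have hBsa : IsSelfAdjoint B := hBpos.isSelfAdjoint
  have hBc : IsCompactOperator B := by
    have := hc.comp_clm P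
    simpa only [hBdef, ContinuousLinearMap.coe_comp, Function.comp_assoc] using this
  have hBnn : ∀ x : E, 0 ≤ RCLike.re ⟪x, B x⟫_ℂ := fun x => hBpos.re_inner_nonneg_right x
  obtain ⟨Ω, hΩ, hBΩ⟩ :=
    Literature.Analysis.OperatorTheory.exists_eigenvector_norm_of_re_inner_nonneg hBsa hBc hBnn
  -- `‖P Q‖² = ‖B‖`
  have hstar : star (P ∘L Q) = Q ∘L P := by
    rw [ContinuousLinearMap.star_eq_adjoint]
    change (P ∘L Q)† = Q ∘L P
    rw [ContinuousLinearMap.adjoint_comp, hPadj, hQadj]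
  have hBeq : B = (P ∘L Q) * star (P ∘L Q) := by
    rw [hstar, ContinuousLinearMap.mul_def, hBdef]
    ext x
    simp only [ContinuousLinearMap.comp_apply]
    rw [show Q (Q (P x)) = Q (P x) from congrArg (fun R : E →L[ℂ] E => R (P x)) hQ.isIdempotentElem.eq]
  have hnormB : ‖B‖ = ‖P ∘L Q‖ * ‖P ∘L Q‖ := by rw [hBeq]; exact CStarRing.norm_self_mul_star
  -- `‖B‖ < 1`
  have hB1 : ‖B‖ ≤ 1 := by
    rw [hnormB]
    have h1 : ‖P ∘L Q‖ ≤ 1 := by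
      calc ‖P ∘L Q‖ ≤ ‖P‖ * ‖Q‖ := ContinuousLinearMap.opNorm_comp_le _ _
        _ ≤ 1 * 1 := mul_le_mul (norm_le_one_of_isStarProjection hP)
            (norm_le_one_of_isStarProjection hQ) (norm_nonneg _) zero_le_one
        _ = 1 := one_mul _
    nlinarith [norm_nonneg (P ∘L Q)]
  have hBlt : ‖B‖ < 1 := by
    refine lt_of_le_of_ne hB1 fun h1 => ?_
    replace hBΩ : B Ω = Ω := by rw [hBΩ, h1]; simp
    -- `Ω ∈ ran P`
    have hΩP : P Ω = Ω := by
      have : Ω ∈ P.range := LinearMap.mem_range.mpr ⟨Q (P Ω), by simpa [hBdef] using hBΩ⟩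
      exact (mem_range_iff_of_isIdempotentElem hP.isIdempotentElem).1 this
    -- `‖Q Ω‖ = ‖Ω‖`
    have hΩQ : Q Ω = Ω := by
      apply apply_eq_self_of_norm_eq hQ
      have hinner : ⟪Ω, B Ω⟫_ℂ = ⟪Ω, Q Ω⟫_ℂ := by
        have hPs := hP.isSelfAdjoint.isSymmetric
        calc ⟪Ω, B Ω⟫_ℂ = ⟪Ω, P (Q (P Ω))⟫_ℂ := by simp [hBdef]
          _ = ⟪P Ω, Q (P Ω)⟫_ℂ := (hPs Ω (Q (P Ω))).symm
          _ = ⟪Ω, Q Ω⟫_ℂ := by rw [hΩP]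
      have h2 : ‖Ω‖ ^ 2 = ‖Q Ω‖ ^ 2 := by
        rw [← re_inner_apply_of_isStarProjection hQ Ω, ← hinner, hBΩ]
        exact (inner_self_eq_norm_sq (𝕜 := ℂ) Ω).symm
      exact ((pow_left_inj₀ (norm_nonneg _) (norm_nonneg _) two_ne_zero).1 h2).symm
    have hmem : Ω ∈ P.range ⊓ Q.range :=
      ⟨(mem_range_iff_of_isIdempotentElem hP.isIdempotentElem).2 hΩP,
        (mem_range_iff_of_isIdempotentElem hQ.isIdempotentElem).2 hΩQ⟩
    rw [hPQ, Submodule.mem_bot] at hmem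
    rw [hmem, norm_zero] at hΩ
    exact zero_ne_one hΩ
  rw [hnormB] at hBlt
  nlinarith [norm_nonneg (P ∘L Q)]

end Abstract

/-! ## B. The pair `𝒫_a`, `𝒫̂_b` on `L²(ℝ)`: compactness of `𝒫_a 𝒫̂_b`, trivial intersection of the ranges -/

section Cutoffs

/-- `L² ⊆ L¹` on a set of finite measure, quantitatively: `∫_s ‖F‖ ≤ √(vol s) ‖F‖₂`. [folklore] -/
private theorem setIntegral_norm_coeFn_le (F : Lp ℂ 2 (volume : Measure ℝ)) {s : Set ℝ}
    (hμs : volume s ≠ ∞) : ∫ x in s, ‖F x‖ ≤ Real.sqrt (volume.real s) * ‖F‖ := by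
  haveI : IsFiniteMeasure (volume.restrict s) := isFiniteMeasure_restrict.2 hμs
  have h1 := Literature.Analysis.OperatorTheory.integral_norm_coeFn_le_sqrt_mul_norm
    (LpToLpRestrictCLM ℝ ℂ ℂ volume 2 s F)
  have h2 : ∫ x, ‖(LpToLpRestrictCLM ℝ ℂ ℂ volume 2 s F : ℝ → ℂ) x‖ ∂(volume.restrict s) =
      ∫ x in s, ‖F x‖ := by
    refine integral_congr_ae ?_
    filter_upwards [LpToLpRestrictCLM_coeFn ℂ s F] with x hx
    rw [hx]
  have h3 : ‖LpToLpRestrictCLM ℝ ℂ ℂ volume 2 s F‖ ≤ ‖F‖ := norm_Lp_toLp_restrict_le s F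
  rw [h2, measureReal_restrict_apply_univ] at h1
  exact h1.trans (mul_le_mul_of_nonneg_left h3 (Real.sqrt_nonneg _))

/-- The zero extension `1_{[−Λ,Λ]} F` of the restriction of `F ∈ L²(ℝ)` is integrable. [folklore] -/
private theorem integrable_indicator_Icc_symm (Λ : ℝ) (F : Lp ℂ 2 (volume : Measure ℝ)) :
    Integrable ((Icc (-Λ) Λ).indicator (F : ℝ → ℂ)) := by
  rw [integrable_indicator_iff measurableSet_Icc]
  exact ((Lp.memLp F).restrict (Icc (-Λ) Λ)).integrable one_le_two

/-- **`𝒫̂_b φ` is the inverse Fourier integral of the integrable function `1_{[−b,b]} 𝓕φ`** (a.e.).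
[cite: ConnesConsani2021, §4 p. 15 eq. (complementproj) (arXiv p0015:L42–L48)] -/
theorem cutoffProjHat_coeFn_ae_eq_fourierInv (b : ℝ) (φ : Lp ℂ 2 (volume : Measure ℝ)) :
    (cutoffProjHat b φ : ℝ → ℂ) =ᵐ[volume]
      𝓕⁻ ((Icc (-b) b).indicator ((𝓕 φ : Lp ℂ 2 (volume : Measure ℝ)) : ℝ → ℂ)) := by
  rw [cutoffProjHat_apply]
  exact Literature.Analysis.FunctionSpaces.SobolevEmbeddingHalf.fourierInv_toLp_ae_eq_fourierIntegralInv
    (integrable_indicator_Icc_symm b _)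
    (Literature.Analysis.OperatorTheory.memLp_indicator_coeFn volume 2 measurableSet_Icc _)

/-- **`𝒫̂_b φ` has a continuous representative** (`𝒫̂_b = 𝓕⁻¹𝒫_b𝓕` and `𝒫_b𝓕φ ∈ L¹`).
[cite: ConnesConsani2021, §4 p. 15 eq. (complementproj) (arXiv p0015:L42–L48)] -/
theorem exists_continuous_ae_eq_cutoffProjHat (b : ℝ) (φ : Lp ℂ 2 (volume : Measure ℝ)) :
    ∃ g : ℝ → ℂ, Continuous g ∧ (cutoffProjHat b φ : ℝ → ℂ) =ᵐ[volume] g :=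
  ⟨_, Literature.Analysis.Fourier.continuous_fourierInv_of_integrable (integrable_indicator_Icc_symm b _),
    cutoffProjHat_coeFn_ae_eq_fourierInv b φ⟩

/-- **Sup-norm bound `‖𝒫̂_b φ‖_∞ ≤ √(vol [−b,b]) ‖φ‖₂`** (`𝓕φ` restricted to `[−b,b]` is in `L¹` with
norm `≤ √(vol) ‖𝓕φ‖₂ = √(vol) ‖φ‖₂`, Plancherel) — the Hilbert–Schmidt ingredient of "the compact operator
`P_λ𝓕₊P_λ`". [cite: Burnol2004, §6, existence paragraph after Def. 6.1 (arXiv p. 22)] -/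
theorem eLpNorm_top_cutoffProjHat_le (b : ℝ) (φ : Lp ℂ 2 (volume : Measure ℝ)) :
    eLpNorm (cutoffProjHat b φ) ∞ volume ≤
      ENNReal.ofReal (Real.sqrt (volume.real (Icc (-b) b)) * ‖φ‖) := by
  set F : Lp ℂ 2 (volume : Measure ℝ) := 𝓕 φ with hF
  set g : ℝ → ℂ := (Icc (-b) b).indicator (F : ℝ → ℂ) with hg
  have hbound : ∀ x, ‖𝓕⁻ g x‖ ≤ Real.sqrt (volume.real (Icc (-b) b)) * ‖φ‖ := by
    intro x
    refine (Literature.Analysis.Fourier.norm_fourierInv_le_integral_norm g x).trans ?_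
    have h1 : ∫ v, ‖g v‖ = ∫ v in Icc (-b) b, ‖F v‖ := by
      rw [← integral_indicator measurableSet_Icc]
      congr 1
      funext v
      rw [hg, norm_indicator_eq_indicator_norm]
    rw [h1]
    have h2 := setIntegral_norm_coeFn_le F (s := Icc (-b) b) measure_Icc_lt_top.ne
    rwa [hF, Lp.norm_fourier_eq] at h2
  rw [eLpNorm_congr_ae (cutoffProjHat_coeFn_ae_eq_fourierInv b φ), eLpNorm_exponent_top]
  exact eLpNormEssSup_le_of_ae_bound (Eventually.of_forall hbound)

/-- **`𝒫_a 𝒫̂_b` is a compact operator on `L²(ℝ)`** (restriction to a set of finite measure of an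
operator with a sup-norm bound is Hilbert–Schmidt; this is the compactness of `P_λ 𝓕₊ P_λ` in
Burnol's argument). [cite: Burnol2004, §6, existence paragraph after Def. 6.1 (arXiv p. 22)] -/
theorem isCompactOperator_cutoffProj_comp_cutoffProjHat (a b : ℝ) :
    IsCompactOperator (cutoffProj a ∘L cutoffProjHat b) :=
  Literature.Analysis.OperatorTheory.isCompactOperator_indicatorLp_comp (cutoffProjHat b)
    measurableSet_Icc measure_Icc_lt_top.ne (by positivity)
    fun φ => (eLpNorm_mono_measure _ Measure.restrict_le_self).trans (eLpNorm_top_cutoffProjHat_le b φ)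

/-- **A time-limited and band-limited `L²` function vanishes**: `ran 𝒫_a ⊓ ran 𝒫̂_b = 0` (the Fourier
transform of a compactly supported `L¹` function is entire; the tree's
`ae_eq_zero_of_fourier_eqOn_Ioo`). [cite: Burnol2004, §6, existence paragraph after Def. 6.1 (arXiv p. 22)] -/
theorem range_cutoffProj_inf_range_cutoffProjHat (a b : ℝ) :
    (cutoffProj a).range ⊓ (cutoffProjHat b).range = ⊥ := by
  rw [eq_bot_iff]
  rintro ξ ⟨hξa, hξb⟩
  rw [Submodule.mem_bot]
  have hPξ : cutoffProj a ξ = ξ :=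
    (mem_range_iff_of_isIdempotentElem (isStarProjection_cutoffProj a).isIdempotentElem).1 hξa
  have hQξ : cutoffProjHat b ξ = ξ :=
    (mem_range_iff_of_isIdempotentElem (isStarProjection_cutoffProjHat b).isIdempotentElem).1 hξb
  -- the integrable representative `ψ = 1_{[−a,a]} ξ`
  set ψ : ℝ → ℂ := (Icc (-a) a).indicator (ξ : ℝ → ℂ) with hψ
  have hψ1 : Integrable ψ := integrable_indicator_Icc_symm a ξ
  have hψ2 : MemLp ψ 2 (volume : Measure ℝ) :=
    Literature.Analysis.OperatorTheory.memLp_indicator_coeFn volume 2 measurableSet_Icc ξ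
  have hξψ : ξ = hψ2.toLp ψ := by
    conv_lhs => rw [← hPξ]
    rfl
  -- `𝓕 ξ` is the (continuous) Fourier integral of `ψ`
  have hFξ : ((𝓕 ξ : Lp ℂ 2 (volume : Measure ℝ)) : ℝ → ℂ) =ᵐ[volume] 𝓕 ψ := by
    rw [hξψ]
    exact Literature.Analysis.FunctionSpaces.fourier_toLp_ae_eq_fourierIntegral hψ1 hψ2
  -- band limitation: `𝓕 ξ` vanishes a.e. off `[−b, b]`
  have hband : cutoffProj b (𝓕 ξ : Lp ℂ 2 (volume : Measure ℝ)) = 𝓕 ξ := by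
    have h1 := congrArg (fun u : Lp ℂ 2 (volume : Measure ℝ) => (𝓕 u : Lp ℂ 2 (volume : Measure ℝ))) hQξ
    simp only [cutoffProjHat_apply, fourier_fourierInv_eq] at h1
    exact h1
  have hzero_ae : ∀ᵐ p : ℝ, p ∉ Icc (-b) b → 𝓕 ψ p = 0 := by
    have h1 := cutoffProj_coeFn b (𝓕 ξ : Lp ℂ 2 (volume : Measure ℝ))
    rw [hband] at h1
    filter_upwards [h1, hFξ] with p hp hp' hpI
    rw [← hp', hp, indicator_of_notMem hpI]
  -- hence everywhere on `(b, b+1)` by continuity, so `ψ = 0` a.e.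
  have hcont : Continuous (𝓕 ψ) := Literature.Analysis.FunctionSpaces.continuous_fourierIntegral hψ1
  have hzero : ∀ p ∈ Ioo b (b + 1), 𝓕 ψ p = 0 := by
    have hae' : 𝓕 ψ =ᵐ[volume.restrict (Ioo b (b + 1))] fun _ => (0 : ℂ) := by
      refine (ae_restrict_iff' measurableSet_Ioo).mpr ?_
      filter_upwards [hzero_ae] with p hp hpI
      exact hp fun h => by linarith [h.2, hpI.1]
    intro p hp
    exact Measure.eqOn_Ioo_of_ae_eq volume hae' hcont.continuousOn continuousOn_const hp
  have hψ0 : ψ =ᵐ[volume] 0 :=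
    Literature.Analysis.Fourier.ae_eq_zero_of_fourier_eqOn_Ioo hψ1 (abs_nonneg a)
      (fun x hx => by
        rw [hψ, indicator_of_notMem]
        intro hxI
        exact hx ⟨by linarith [hxI.1, le_abs_self a], hxI.2.trans (le_abs_self a)⟩)
      (by linarith) hzero
  rw [hξψ]
  exact (Lp.eq_zero_iff_ae_eq_zero).mpr ((MemLp.coeFn_toLp hψ2).trans hψ0)

/-- **`‖𝒫_a 𝒫̂_b‖ < 1`** on `L²(ℝ)` (Burnol: "the compact operator `P_λ 𝓕₊ P_λ` has operator bound
strictly less than one, as no function can be compactly supported and with its Fourier compactly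
supported"). [cite: Burnol2004, §6, existence paragraph after Def. 6.1 (arXiv p. 22)] -/
theorem norm_cutoffProj_comp_cutoffProjHat_lt_one (a b : ℝ) :
    ‖cutoffProj a ∘L cutoffProjHat b‖ < 1 :=
  norm_comp_lt_one_of_isCompactOperator (isStarProjection_cutoffProj a)
    (isStarProjection_cutoffProjHat b) (isCompactOperator_cutoffProj_comp_cutoffProjHat a b)
    (range_cutoffProj_inf_range_cutoffProjHat a b)

/-- **`ran 𝒫_a + ran 𝒫̂_b` is a closed subspace of `L²(ℝ)`** (Burnol: "`L²(0,λ) + 𝓕₊(L²(0,λ))` is a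
closed … subspace of `L²(0,∞)`"). [cite: Burnol2004, §6, existence paragraph after Def. 6.1 (arXiv p. 22)] -/
theorem isClosed_range_cutoffProj_sup_range_cutoffProjHat (a b : ℝ) :
    IsClosed (((cutoffProj a).range ⊔ (cutoffProjHat b).range :
      Submodule ℂ (Lp ℂ 2 (volume : Measure ℝ))) : Set (Lp ℂ 2 (volume : Measure ℝ))) :=
  isClosed_range_sup_range (isStarProjection_cutoffProj a) (isStarProjection_cutoffProjHat b)
    (norm_cutoffProj_comp_cutoffProjHat_lt_one a b)

end Cutoffs

/-! ## C. Non-triviality of Sonin's space `S(a, b)` -/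

section Nonvanishing

/-- An `L²` function fixed by the reflection is even. [folklore] -/
private theorem mem_evenPart_of_compNeg_eq {u : Lp ℂ 2 (volume : Measure ℝ)}
    (hu : Lp.compMeasurePreserving (fun x : ℝ => -x) (Measure.measurePreserving_neg (volume : Measure ℝ)) u = u) :
    u ∈ evenPart := by
  rw [mem_evenPart_iff]
  have h := Literature.Analysis.Fourier.coeFn_compNeg (F := ℂ) u
  rw [hu] at h
  filter_upwards [h] with x hx
  exact hx.symm

/-- `𝒫̂_b` commutes with the reflection. [cite: ConnesConsani2021, §4 p. 15 eq. (complementproj) (arXiv p0015:L42–L48)] -/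
theorem compNeg_cutoffProjHat (b : ℝ) (u : Lp ℂ 2 (volume : Measure ℝ)) :
    Lp.compMeasurePreserving (fun x : ℝ => -x) (Measure.measurePreserving_neg (volume : Measure ℝ))
        (cutoffProjHat b u) =
      cutoffProjHat b (Lp.compMeasurePreserving (fun x : ℝ => -x) (Measure.measurePreserving_neg (volume : Measure ℝ)) u) := by
  rw [cutoffProjHat_apply, cutoffProjHat_apply, Literature.Analysis.Fourier.fourier_compNeg,
    ← compNeg_cutoffProj, Literature.Analysis.Fourier.fourierInv_compNeg]

/-- For a star projection `P` and `z ⊥ ran P`: `P z = 0`. [folklore] -/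
private theorem apply_eq_zero_of_mem_orthogonal_range {E : Type*} [NormedAddCommGroup E]
    [InnerProductSpace ℂ E] [CompleteSpace E] {P : E →L[ℂ] E} (hP : IsStarProjection P) {z : E}
    (hz : z ∈ P.rangeᗮ) : P z = 0 := by
  have h1 : ⟪P z, z⟫_ℂ = 0 :=
    Submodule.inner_right_of_mem_orthogonal (LinearMap.mem_range_self (P : E →ₗ[ℂ] E) z) hz
  have h2 : RCLike.re ⟪z, P z⟫_ℂ = ‖P z‖ ^ 2 := re_inner_apply_of_isStarProjection hP z
  rw [← inner_conj_symm, h1, map_zero, map_zero] at h2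
  exact norm_eq_zero.1 (sq_eq_zero_iff.1 h2.symm)

/-- For a star projection `P` with `P z = 0`: `z ⊥ ran P`. [folklore] -/
private theorem mem_orthogonal_range_of_apply_eq_zero {E : Type*} [NormedAddCommGroup E]
    [InnerProductSpace ℂ E] [CompleteSpace E] {P : E →L[ℂ] E} (hP : IsStarProjection P) {z : E}
    (hz : P z = 0) : z ∈ P.rangeᗮ := by
  rw [Submodule.mem_orthogonal]
  rintro u ⟨w, rfl⟩
  have hPs := hP.isSelfAdjoint.isSymmetric
  calc ⟪P w, z⟫_ℂ = ⟪w, P z⟫_ℂ := hPs w z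
    _ = 0 := by rw [hz, inner_zero_right]

variable {a b : ℝ}

/-- The even test set `A = (a+1, a+2) ∪ (−(a+2), −(a+1))` is measurable. [folklore] -/
private theorem measurableSet_testSet (a : ℝ) :
    MeasurableSet (Ioo (a + 1) (a + 2) ∪ Ioo (-(a + 2)) (-(a + 1))) :=
  measurableSet_Ioo.union measurableSet_Ioo

/-- The test set has finite measure. [folklore] -/
private theorem volume_testSet_ne_top (a : ℝ) :
    volume (Ioo (a + 1) (a + 2) ∪ Ioo (-(a + 2)) (-(a + 1))) ≠ ∞ :=
  ((measure_union_le _ _).trans_lt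
    (ENNReal.add_lt_top.2 ⟨measure_Ioo_lt_top, measure_Ioo_lt_top⟩)).ne

/-- **The even step function `1_{a+1<|x|<a+2}` is NOT in `ran 𝒫_a + ran 𝒫̂_b`** (`a ≥ 0`): on `|x| > a`
it would agree a.e. with a band-limited, hence continuous, function, which cannot jump from `0` to `1`
at `x = a + 1` (Burnol: the closed subspace `L²(0,λ) + 𝓕₊L²(0,λ)` is "obviously proper").
[cite: Burnol2004, §6, existence paragraph after Def. 6.1 (arXiv p. 22)] -/
theorem indicatorConstLp_notMem_range_sup_range (ha : 0 ≤ a) (b : ℝ) :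
    indicatorConstLp 2 (measurableSet_testSet a) (volume_testSet_ne_top a) (1 : ℂ) ∉
      (cutoffProj a).range ⊔ (cutoffProjHat b).range := by
  intro h
  obtain ⟨p, hp, q, hq, hpq⟩ := Submodule.mem_sup.mp h
  obtain ⟨x, rfl⟩ := LinearMap.mem_range.mp hp
  obtain ⟨y, rfl⟩ := LinearMap.mem_range.mp hq
  obtain ⟨g, hgc, hgq⟩ := exists_continuous_ae_eq_cutoffProjHat b y
  set A : Set ℝ := Ioo (a + 1) (a + 2) ∪ Ioo (-(a + 2)) (-(a + 1)) with hA
  have hv := indicatorConstLp_coeFn (p := (2 : ℝ≥0∞)) (hs := measurableSet_testSet a)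
    (hμs := volume_testSet_ne_top a) (c := (1 : ℂ))
  have hae : ∀ᵐ t : ℝ, A.indicator (fun _ => (1 : ℂ)) t =
      (Icc (-a) a).indicator (x : ℝ → ℂ) t + g t := by
    have hpq' : cutoffProj a x + cutoffProjHat b y =
        indicatorConstLp 2 (measurableSet_testSet a) (volume_testSet_ne_top a) (1 : ℂ) := hpq
    have hsum := Lp.coeFn_add (cutoffProj a x) (cutoffProjHat b y)
    rw [hpq'] at hsum
    filter_upwards [hsum, hv, cutoffProj_coeFn a x, hgq] with t h1 h2 h3 h4
    rw [← h2, h1, Pi.add_apply]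
    change (cutoffProj a x : ℝ → ℂ) t + (cutoffProjHat b y : ℝ → ℂ) t = _
    rw [h3, h4]
  -- on `(a, a+1)`: `g = 0`
  have h0 : ∀ t ∈ Ioo a (a + 1), g t = 0 := by
    have hae' : g =ᵐ[volume.restrict (Ioo a (a + 1))] fun _ => (0 : ℂ) := by
      refine (ae_restrict_iff' measurableSet_Ioo).mpr ?_
      filter_upwards [hae] with t ht htI
      have h1 : t ∉ Icc (-a) a := fun h => by linarith [h.2, htI.1]
      have h2 : t ∉ A := by
        rintro (h | h)
        · linarith [h.1, htI.2]
        · linarith [h.2, htI.1]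
      rw [indicator_of_notMem h2, indicator_of_notMem h1, zero_add] at ht
      exact ht.symm
    intro t ht
    exact Measure.eqOn_Ioo_of_ae_eq volume hae' hgc.continuousOn continuousOn_const ht
  -- on `(a+1, a+2)`: `g = 1`
  have h1 : ∀ t ∈ Ioo (a + 1) (a + 2), g t = 1 := by
    have hae' : g =ᵐ[volume.restrict (Ioo (a + 1) (a + 2))] fun _ => (1 : ℂ) := by
      refine (ae_restrict_iff' measurableSet_Ioo).mpr ?_
      filter_upwards [hae] with t ht htI
      have h1 : t ∉ Icc (-a) a := fun h => by linarith [h.2, htI.1]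
      have h2 : t ∈ A := Or.inl htI
      rw [indicator_of_mem h2, indicator_of_notMem h1, zero_add] at ht
      exact ht.symm
    intro t ht
    exact Measure.eqOn_Ioo_of_ae_eq volume hae' hgc.continuousOn continuousOn_const ht
  -- continuity at `a + 1`
  have hleft : g (a + 1) = 0 := by
    have := (Set.EqOn.of_subset_closure (f := g) (g := fun _ => (0 : ℂ)) h0 hgc.continuousOn
      continuousOn_const Ioo_subset_Icc_self (by rw [closure_Ioo (by linarith)]))
    exact this ⟨by linarith, le_rfl⟩
  have hright : g (a + 1) = 1 := by
    have := (Set.EqOn.of_subset_closure (f := g) (g := fun _ => (1 : ℂ)) h1 hgc.continuousOn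
      continuousOn_const Ioo_subset_Icc_self (by rw [closure_Ioo (by linarith)]))
    exact this ⟨le_rfl, by linarith⟩
  exact one_ne_zero (hright.symm.trans hleft)

/-- The test step function `1_A` is even (`A` is symmetric). [folklore] -/
private theorem compNeg_indicatorConstLp_testSet (a : ℝ) :
    Lp.compMeasurePreserving (fun x : ℝ => -x) (Measure.measurePreserving_neg (volume : Measure ℝ))
        (indicatorConstLp 2 (measurableSet_testSet a) (volume_testSet_ne_top a) (1 : ℂ)) =
      indicatorConstLp 2 (measurableSet_testSet a) (volume_testSet_ne_top a) (1 : ℂ) := by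
  refine Lp.ext ?_
  have hv := indicatorConstLp_coeFn (p := (2 : ℝ≥0∞)) (hs := measurableSet_testSet a)
    (hμs := volume_testSet_ne_top a) (c := (1 : ℂ))
  have h1 := (Measure.measurePreserving_neg (volume : Measure ℝ)).quasiMeasurePreserving.ae_eq_comp hv
  filter_upwards [Literature.Analysis.Fourier.coeFn_compNeg (F := ℂ)
    (indicatorConstLp 2 (measurableSet_testSet a) (volume_testSet_ne_top a) (1 : ℂ)), h1, hv]
    with t ht1 ht2 ht3
  rw [ht1]
  simp only [Function.comp_apply] at ht2
  rw [ht2, ht3]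
  have hmem : -t ∈ Ioo (a + 1) (a + 2) ∪ Ioo (-(a + 2)) (-(a + 1)) ↔
      t ∈ Ioo (a + 1) (a + 2) ∪ Ioo (-(a + 2)) (-(a + 1)) := by
    simp only [mem_union, mem_Ioo]
    constructor
    · rintro (⟨h1, h2⟩ | ⟨h1, h2⟩)
      · exact Or.inr ⟨by linarith, by linarith⟩
      · exact Or.inl ⟨by linarith, by linarith⟩
    · rintro (⟨h1, h2⟩ | ⟨h1, h2⟩)
      · exact Or.inr ⟨by linarith, by linarith⟩
      · exact Or.inl ⟨by linarith, by linarith⟩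
  by_cases ht : t ∈ Ioo (a + 1) (a + 2) ∪ Ioo (-(a + 2)) (-(a + 1))
  · rw [indicator_of_mem (hmem.2 ht), indicator_of_mem ht]
  · rw [indicator_of_notMem (fun h => ht (hmem.1 h)), indicator_of_notMem ht]

/-- **Sonin's space `S(a, b)` is non-zero** (`a ≥ 0`, any `b`): N. Sonin (1880) / de Branges (1964);
the elementary existence proof printed by Burnol — `ran 𝒫_a + ran 𝒫̂_b` is closed (`‖𝒫_a𝒫̂_b‖ < 1`) and
proper, and the even part of its orthogonal complement is `S(a, b)`.
[cite: Burnol2004, §6, existence paragraph after Def. 6.1 (arXiv p. 22); Burnol2004b, §2 p. 5] -/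
theorem exists_mem_soninSpace_ne_zero (ha : 0 ≤ a) (b : ℝ) :
    ∃ s ∈ soninSpace a b, s ≠ 0 := by
  set R : Lp ℂ 2 (volume : Measure ℝ) →+ Lp ℂ 2 (volume : Measure ℝ) :=
    Lp.compMeasurePreserving (fun x : ℝ => -x) (Measure.measurePreserving_neg (volume : Measure ℝ)) with hRdef
  set P := cutoffProj a with hPdef
  set Q := cutoffProjHat b with hQdef
  have hP : IsStarProjection P := isStarProjection_cutoffProj a
  have hQ : IsStarProjection Q := isStarProjection_cutoffProjHat b
  set W : Submodule ℂ (Lp ℂ 2 (volume : Measure ℝ)) := P.range ⊔ Q.range with hWdef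
  have hWc : IsClosed (W : Set (Lp ℂ 2 (volume : Measure ℝ))) :=
    isClosed_range_cutoffProj_sup_range_cutoffProjHat a b
  haveI : CompleteSpace W := hWc.completeSpace_coe
  set v : Lp ℂ 2 (volume : Measure ℝ) :=
    indicatorConstLp 2 (measurableSet_testSet a) (volume_testSet_ne_top a) (1 : ℂ) with hvdef
  set s : Lp ℂ 2 (volume : Measure ℝ) := v - W.starProjection v with hsdef
  have hsW : s ∈ Wᗮ := Submodule.sub_starProjection_mem_orthogonal v
  -- `Wᗮ = ker P ∩ ker Q`
  have hWorth : ∀ z : Lp ℂ 2 (volume : Measure ℝ), z ∈ Wᗮ ↔ P z = 0 ∧ Q z = 0 := by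
    intro z
    rw [hWdef, ← Submodule.inf_orthogonal, Submodule.mem_inf]
    exact ⟨fun h => ⟨apply_eq_zero_of_mem_orthogonal_range hP h.1,
        apply_eq_zero_of_mem_orthogonal_range hQ h.2⟩,
      fun h => ⟨mem_orthogonal_range_of_apply_eq_zero hP h.1,
        mem_orthogonal_range_of_apply_eq_zero hQ h.2⟩⟩
  obtain ⟨hPs, hQs⟩ := (hWorth s).1 hsW
  -- `W` and `Wᗮ` are stable under the reflection
  have hRW : ∀ w ∈ W, R w ∈ W := by
    intro w hw
    obtain ⟨p, hp, q, hq, rfl⟩ := Submodule.mem_sup.mp hw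
    obtain ⟨x, rfl⟩ := LinearMap.mem_range.mp hp
    obtain ⟨y, rfl⟩ := LinearMap.mem_range.mp hq
    rw [map_add]
    refine Submodule.add_mem _ (Submodule.mem_sup_left ?_) (Submodule.mem_sup_right ?_)
    · exact LinearMap.mem_range.mpr ⟨R x, (compNeg_cutoffProj a x).symm⟩
    · exact LinearMap.mem_range.mpr ⟨R y, (compNeg_cutoffProjHat b y).symm⟩
  have hRs : R s ∈ Wᗮ := by
    rw [hWorth]
    constructor
    · change cutoffProj a (R s) = 0
      rw [← compNeg_cutoffProj, show cutoffProj a s = 0 from hPs, map_zero]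
    · change cutoffProjHat b (R s) = 0
      rw [← compNeg_cutoffProjHat, show cutoffProjHat b s = 0 from hQs, map_zero]
  -- hence `s` is even
  have hv_even : R v = v := compNeg_indicatorConstLp_testSet a
  have hseven : s ∈ evenPart := by
    apply mem_evenPart_of_compNeg_eq
    have hw : v - s ∈ W := by
      rw [hsdef, sub_sub_cancel]
      exact Submodule.starProjection_apply_mem W v  -- `P_W v ∈ W`
    have hRw : R (v - s) ∈ W := hRW _ hw
    rw [map_sub, hv_even] at hRw
    have hdiff : s - R s ∈ W := by
      have := Submodule.sub_mem W hRw hw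
      rwa [sub_sub_sub_cancel_left] at this
    have hdiff' : s - R s ∈ Wᗮ := Submodule.sub_mem _ hsW hRs
    have h0 : s - R s = 0 := by
      have := Submodule.mem_inf.mpr ⟨hdiff, hdiff'⟩
      rwa [Submodule.inf_orthogonal_eq_bot, Submodule.mem_bot] at this
    exact (sub_eq_zero.mp h0).symm
  refine ⟨s, mem_soninSpace_iff_cutoffProj.mpr ⟨hseven, hPs, hQs⟩, fun hs0 => ?_⟩
  -- `s = 0` would put the test function in `W`
  have hvW : v ∈ W := by
    rw [← Submodule.starProjection_eq_self_iff]
    exact (sub_eq_zero.mp (hsdef ▸ hs0 : v - W.starProjection v = 0)).symm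
  exact indicatorConstLp_notMem_range_sup_range ha b hvW

/-- **`S(a, b) ≠ ⊥` for all real `a`, `b`** (`S(a, b) ⊇ S(max(a,0), b)`).
[cite: Burnol2004, §6 Thm. 6.3 («The spaces `K_λ` are all non-reduced to `{0}`») (arXiv:math/0112254 p. 22)] -/
theorem soninSpace_ne_bot (a b : ℝ) : soninSpace a b ≠ ⊥ := by
  obtain ⟨s, hs, hs0⟩ := exists_mem_soninSpace_ne_zero (le_max_right a 0) b
  have hs' : s ∈ soninSpace a b := soninSpace_antitone (le_max_left a 0) le_rfl hs
  exact fun h => hs0 ((Submodule.mem_bot ℂ).mp (h ▸ hs'))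

end Nonvanishing

/-! ## D. Sonin's space is infinite dimensional -/

section InfiniteDimensional

/-- **Sonin's space `S(a, b)`, `a ≥ 0`, is infinite dimensional** ("the `L_a`'s … compose a strictly
decreasing chain of non-trivial infinite dimensional subspaces", Burnol).  Proof: the spaces
`S(a+n, b+n)`, `n ∈ ℕ`, form a decreasing chain of NON-ZERO (`exists_mem_soninSpace_ne_zero`) subspaces
of `S(a, b)` with zero intersection; in a finite-dimensional `S(a, b)` the chain would be eventually
constant, hence eventually zero.
[cite: Burnol2004b, §2 p. 5 (arXiv:math/0203120 chunk p0005:L10); Burnol2004, §6 Prop. 6.6 (arXiv:math/0112254 p. 22)] -/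
theorem not_finiteDimensional_soninSpace_of_nonneg {a b : ℝ} (ha : 0 ≤ a) :
    ¬ FiniteDimensional ℂ (soninSpace a b) := by
  intro hfin
  set S := soninSpace a b with hSdef
  set c : ℕ → Submodule ℂ S := fun n => (soninSpace (a + n) (b + n)).comap S.subtype with hcdef
  have hanti : Antitone c := by
    intro m n hmn
    exact Submodule.comap_mono (soninSpace_antitone (by simpa using hmn) (by simpa using hmn))
  set f : ℕ → ℕ := fun n => Module.finrank ℂ (c n) with hfdef
  have hf : Antitone f := fun m n hmn => Submodule.finrank_mono (hanti hmn)
  -- the dimensions are eventually constant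
  obtain ⟨N, hN⟩ : ∃ N, ∀ n, N ≤ n → f n = f N :=
    ⟨Function.argmin f, fun n hn => le_antisymm (hf hn) (Function.argmin_le f n)⟩
  have hcN : ∀ n, N ≤ n → c n = c N := fun n hn =>
    Submodule.eq_of_le_of_finrank_eq (hanti hn) (hN n hn)
  -- a non-zero vector of `S(a+N, b+N)` lies in every `S(a+n, b+n)`
  obtain ⟨s, hs, hs0⟩ := exists_mem_soninSpace_ne_zero (a := a + N) (by positivity) (b + N)
  have hsS : s ∈ S := soninSpace_antitone (by simp) (by simp) hs
  have hall : ∀ n, N ≤ n → s ∈ soninSpace (a + n) (b + n) := by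
    intro n hn
    have h1 : (⟨s, hsS⟩ : S) ∈ c N := hs
    rw [← hcN n hn] at h1
    exact h1
  -- hence `s = 0` a.e.
  have hae : ∀ᵐ x : ℝ, ∀ n : ℕ, N ≤ n → x ∈ Icc (-(a + n)) (a + n) → (s : ℝ → ℂ) x = 0 := by
    rw [ae_all_iff]
    intro n
    by_cases hn : N ≤ n
    · filter_upwards [((mem_soninSpace_iff _ _ s).1 (hall n hn)).2.1] with x hx _ hxI
      exact hx hxI
    · exact Eventually.of_forall fun x h => (hn h).elim
  have hs_zero : s = 0 := by
    refine (Lp.eq_zero_iff_ae_eq_zero).mpr ?_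
    filter_upwards [hae] with x hx
    set n : ℕ := max N ⌈|x|⌉₊ with hn
    have hNn : N ≤ n := le_max_left _ _
    have hxn : |x| ≤ (n : ℝ) := (Nat.le_ceil |x|).trans (by exact_mod_cast le_max_right N ⌈|x|⌉₊)
    exact hx n hNn ⟨by linarith [neg_abs_le x], by linarith [le_abs_self x]⟩
  exact hs0 hs_zero

/-- **Sonin's space `S(a, b)` is infinite dimensional, for all real `a`, `b`** (for `a < 0` the first
window is empty and `S(a, b) ⊇ S(0, b)`).  In particular `S(1,1)`, the space of N. Sonin (1880), is
infinite dimensional (L. de Branges 1964; Burnol: "non-trivial infinite dimensional subspaces"; for the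
full — not only even — joint complement and arbitrary sets of finite measure see Amrein–Berthier, J.
Funct. Anal. 24 (1977), Prop. 3 p. 260).
[cite: Burnol2004b, §2 p. 5 (arXiv:math/0203120 chunk p0005:L10); Burnol2004, §6 Thm. 6.3, Prop. 6.6 (arXiv:math/0112254 p. 22); AmreinBerthier1977, Prop. 3 p. 260 (whole joint complement, sets of finite measure)] -/
theorem not_finiteDimensional_soninSpace (a b : ℝ) : ¬ FiniteDimensional ℂ (soninSpace a b) := by
  rcases le_or_gt 0 a with ha | ha
  · exact not_finiteDimensional_soninSpace_of_nonneg ha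
  · intro hfin
    have hle : soninSpace 0 b ≤ soninSpace a b := soninSpace_antitone ha.le le_rfl
    haveI : FiniteDimensional ℂ (soninSpace 0 b) := Submodule.finiteDimensional_of_le hle
    exact not_finiteDimensional_soninSpace_of_nonneg (b := b) le_rfl this

end InfiniteDimensional

/-! ## E. Discharge of Connes–Consani JNT 2021 Theorem 5.3 (i) -/

namespace QuasiInner

/-- **Theorem 5.3 (i) of Connes–Consani, *Quasi-inner functions and local factors* (JNT 2021) —
DISCHARGED**: every Sonin space `S(u(F))` is infinite dimensional.  The printed proof (§5.4) reduces it
to the infinite dimensionality of the classical Sonin space `S(1,1)` (the tree's PROVED reduction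
`thm_5_3_i_of_not_finiteDimensional_soninSpace`, seat t18), which is `not_finiteDimensional_soninSpace`.
RH-FREE. [cite: ConnesConsani2021QuasiInner, Thm 5.3 (i) (arXiv chunk p0015:L22; proof §5.4 p0016:L29)] -/
theorem thm_5_3_i_holds : thm_5_3_i :=
  thm_5_3_i_of_not_finiteDimensional_soninSpace (not_finiteDimensional_soninSpace 1 1)

end QuasiInner

end Literature.NumberTheory.ConnesConsani2021
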